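import Summits.CriticalPhenomena.SAWScalingLimit.Theorems.SAWDevelopingMapNoFoldBoundMiddleLoop
import Summits.CriticalPhenomena.SAWScalingLimit.Theorems.SAWDevelopingMapNoFoldBoundSourceLoopReduction

/-!
# Raw middle-port dominance implies dressed middle-port dominance

Helper file for the crux `NoFoldBound` (stmt-CriticalPhenomena-8296) of the route
`SAWDevelopingMap` (sub-problem `SAWScalingLimit` of `CriticalPhenomena`), line `Ideator3Sketch`,
stubs `dom_of_rawDominance` and `domSrc_of_rawDominanceSrc`.

Setting (Duminil-Copin–Smirnov 2012, §2): a finite vertex set `Λ` of the hexagonal lattice with a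
connected complement, a source mid-edge `a ∈ ∂Ω`, a vertex `v ∈ Λ` off `a` with neighbours
`w₀, w₁, w₂` in the positive order, `w₀ ∈ Λ` touching the complement (`w₀ ∼ x ∉ Λ`, third
neighbour `y`).  For a port `w` of `v` put

* the RAW first-arrival mass `N_w = Σ_{γ : a → {v, w}, v ∉ γ} x_c^{ℓ(γ)}`;
* the DRESSED mass `s_w(p, q) = Σ_{γ : a → {v, w}, v ∉ γ} x_c^{ℓ(γ)} (α_T − √3 x_c Z_γ(p, q))`, where
  `α_T = 1 + 2 x_c cos(5π/24)` and `Z_γ(p, q)` is the generating function of the SLIT LOOPS of `γ`,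
  the self-avoiding walks of `(Λ ∖ γ) ∖ {v}` from the mid-edge `{v, p}` to the mid-edge `{v, q}`.

The dressed middle-port dominance (`hdom`, `hdomSrc` of `noFold_collarTwo`; the conclusion of
`stub_portDominance` / `stub_portDominanceSrc`) says that the dressed mass of the MIDDLE port
(`w₁` if `y → w₀ → v` turns left, `w₂` if it turns right) is at least the smaller of the dressed
masses of the two other ports.  We derive it from the same statement for the RAW masses:

* `dom_of_rawDominance` — touching neighbour `w₀` off the source;
* `domSrc_of_rawDominanceSrc` — touching neighbour on the source, `a = {x, w₀}`.

## Proof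

Every dressed term is at most `α_T` times the raw term, because a loop sum is `≥ 0`
(`dressedMass_le_alphaT_mul_rawMass`); and at the middle port the dressed mass EQUALS `α_T` times
the raw mass (`dressedMass_eq_alphaT_mul_rawMass`), because the slit-loop type is empty: off the
source this is `middle_port_no_slit_loop` (discrete Jordan), and in the source position every walk
from `a = {x, w₀}` starts at `w₀` (`src_mem_verts`), so `w₀` is not a vertex of the slit domain
and no walk of it starts or ends on the mid-edge `{v, w₀}` (`isEmpty_saw_of_notMem`,
`isEmpty_saw_of_notMem_fst`).  Hence
`min(s_{w₀}, s_out) ≤ α_T min(N_{w₀}, N_out) ≤ α_T N_mid = s_mid` (`min_le_of_le_mul`).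
-/

noncomputable section

open scoped BigOperators
open Literature.Probability.LatticeModels Literature.Probability.RandomPlanarGeometry.SAW

namespace Summit.CriticalPhenomena.SAWScalingLimit.Theorems.SAWDevelopingMapNoFoldBound

/-! ### Comparison of the dressed and the raw masses of a port -/

/-- A slit-loop sum (a sum of powers of `x_c ≥ 0`) is nonnegative. [folklore] -/
theorem slitLoopSum_nonneg (Λ' : Finset HexVertex) (b z : Sym2 HexVertex) :
    0 ≤ ∑ δ : HexMidEdgeSAW Λ' b z, hexCriticalFugacity ^ δ.length :=
  Finset.sum_nonneg fun _ _ => pow_nonneg nfb_xc_pos.le _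

/-- **Dressed ≤ `α_T` · raw.** The dressed first-arrival mass of a port `w` (loop sums between the
mid-edges `{v, p}` and `{v, q}`) is at most `α_T` times its raw first-arrival mass: each dressing
factor `α_T − √3 x_c Z` is at most `α_T` since `Z ≥ 0`. [folklore] -/
theorem dressedMass_le_alphaT_mul_rawMass (Λ : Finset HexVertex) (a : Sym2 HexVertex)
    (v w p q : HexVertex) :
    (∑ γ : HexMidEdgeSAW Λ a s(v, w), if v ∉ γ.verts then hexCriticalFugacity ^ γ.length *
        (1 + 2 * hexCriticalFugacity * Real.cos (5 * Real.pi / 24) -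
          Real.sqrt 3 * hexCriticalFugacity *
            ∑ δ : HexMidEdgeSAW ((Λ \ γ.verts.toFinset).erase v) s(v, p) s(v, q),
              hexCriticalFugacity ^ δ.length) else 0) ≤
      (1 + 2 * hexCriticalFugacity * Real.cos (5 * Real.pi / 24)) *
        ∑ γ : HexMidEdgeSAW Λ a s(v, w),
          if v ∉ γ.verts then hexCriticalFugacity ^ γ.length else 0 := by
  rw [Finset.mul_sum]
  refine Finset.sum_le_sum fun γ _ => ?_
  split_ifs with hγ
  · rw [mul_zero]
  · have hx : 0 ≤ hexCriticalFugacity := nfb_xc_pos.le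
    have hpow : 0 ≤ hexCriticalFugacity ^ γ.length := pow_nonneg hx _
    have hZ : 0 ≤ Real.sqrt 3 * hexCriticalFugacity *
        ∑ δ : HexMidEdgeSAW ((Λ \ γ.verts.toFinset).erase v) s(v, p) s(v, q),
          hexCriticalFugacity ^ δ.length :=
      mul_nonneg (mul_nonneg (Real.sqrt_nonneg 3) hx) (slitLoopSum_nonneg _ _ _)
    calc _ ≤ hexCriticalFugacity ^ γ.length *
          (1 + 2 * hexCriticalFugacity * Real.cos (5 * Real.pi / 24)) :=
          mul_le_mul_of_nonneg_left (sub_le_self _ hZ) hpow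
      _ = _ := mul_comm _ _

/-- **Dressed = `α_T` · raw when there is no slit loop.** If for every first arrival `γ` at the port
`w` the slit domain `(Λ ∖ γ) ∖ {v}` carries no self-avoiding walk from `{v, p}` to `{v, q}`, then the
dressed mass of `w` is exactly `α_T` times its raw mass. [folklore] -/
theorem dressedMass_eq_alphaT_mul_rawMass (Λ : Finset HexVertex) (a : Sym2 HexVertex)
    (v w p q : HexVertex)
    (h : ∀ γ : HexMidEdgeSAW Λ a s(v, w), v ∉ γ.verts →
      IsEmpty (HexMidEdgeSAW ((Λ \ γ.verts.toFinset).erase v) s(v, p) s(v, q))) :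
    (∑ γ : HexMidEdgeSAW Λ a s(v, w), if v ∉ γ.verts then hexCriticalFugacity ^ γ.length *
        (1 + 2 * hexCriticalFugacity * Real.cos (5 * Real.pi / 24) -
          Real.sqrt 3 * hexCriticalFugacity *
            ∑ δ : HexMidEdgeSAW ((Λ \ γ.verts.toFinset).erase v) s(v, p) s(v, q),
              hexCriticalFugacity ^ δ.length) else 0) =
      (1 + 2 * hexCriticalFugacity * Real.cos (5 * Real.pi / 24)) *
        ∑ γ : HexMidEdgeSAW Λ a s(v, w),
          if v ∉ γ.verts then hexCriticalFugacity ^ γ.length else 0 := by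
  rw [Finset.mul_sum]
  refine Finset.sum_congr rfl fun γ _ => ?_
  split_ifs with hγ
  · rw [mul_zero]
  · haveI := h γ hγ
    rw [Fintype.sum_empty, mul_zero, sub_zero, mul_comm]

/-- **The elementary step**: if `s₀ ≤ α N₀`, `s₂ ≤ α N₂`, `s₁ = α N₁` with `α ≥ 0` and
`min(N₀, N₂) ≤ N₁`, then `min(s₀, s₂) ≤ s₁`. [folklore] -/
theorem min_le_of_le_mul {α s₀ s₁ s₂ N₀ N₁ N₂ : ℝ} (hα : 0 ≤ α) (h₀ : s₀ ≤ α * N₀)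
    (h₂ : s₂ ≤ α * N₂) (h₁ : s₁ = α * N₁) (hN : min N₀ N₂ ≤ N₁) : min s₀ s₂ ≤ s₁ := by
  rcases le_total N₀ N₂ with h | h
  · rw [min_eq_left h] at hN
    calc min s₀ s₂ ≤ s₀ := min_le_left _ _
      _ ≤ α * N₀ := h₀
      _ ≤ α * N₁ := mul_le_mul_of_nonneg_left hN hα
      _ = s₁ := h₁.symm
  · rw [min_eq_right h] at hN
    calc min s₀ s₂ ≤ s₂ := min_le_right _ _
      _ ≤ α * N₂ := h₂
      _ ≤ α * N₁ := mul_le_mul_of_nonneg_left hN hα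
      _ = s₁ := h₁.symm

/-! ### The source position: every walk from `a = {x, w₀}` passes through `w₀` -/

/-- A nontrivial walk from the boundary mid-edge `{x, w₀}` (`x ∉ Λ`) starts at `w₀`, so `w₀` is one
of its vertices. [folklore] -/
theorem src_mem_verts {Λ : Finset HexVertex} {x w₀ : HexVertex} {z : Sym2 HexVertex} (hx : x ∉ Λ)
    (hz : s(x, w₀) ≠ z) (γ : HexMidEdgeSAW Λ s(x, w₀) z) : w₀ ∈ γ.verts := by
  obtain ⟨u, rest, hu⟩ : ∃ u rest, γ.verts = u :: rest :=
    List.exists_cons_of_ne_nil fun h => hz (γ.eq_of_nil h)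
  have hua : u ∈ s(x, w₀) := γ.head_mem u (by rw [hu]; rfl)
  have huΛ : u ∈ Λ := γ.subset u (by rw [hu]; exact List.mem_cons_self)
  rcases Sym2.mem_iff.1 hua with rfl | rfl
  · exact absurd huΛ hx
  · rw [hu]; exact List.mem_cons_self

/-- In the source position `a = {x, w₀}` (`x ∉ Λ`, `v ∉ a`, `v ∼ w₀`), the slit domain
`(Λ ∖ γ) ∖ {v}` of a first arrival `γ` at any port `w` of `v` carries no walk ENDING on the mid-edge
`{v, w₀}` from a different mid-edge `{v, p}` (`p ≠ w₀`): both `v` and `w₀ ∈ γ` are off the slit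
domain. [folklore] -/
theorem isEmpty_slitLoop_to_src {Λ : Finset HexVertex} {x w₀ v w p : HexVertex} (hx : x ∉ Λ)
    (hva : v ∉ s(x, w₀)) (h₀ : hexGraph.Adj v w₀) (hp : p ≠ w₀)
    (γ : HexMidEdgeSAW Λ s(x, w₀) s(v, w)) :
    IsEmpty (HexMidEdgeSAW ((Λ \ γ.verts.toFinset).erase v) s(v, p) s(v, w₀)) := by
  have hw₀ : w₀ ∈ γ.verts := src_mem_verts hx (fun h => hva (h ▸ Sym2.mem_mk_left v w)) γ
  refine isEmpty_saw_of_notMem (fun h => (Finset.mem_erase.1 h).1 rfl)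
    (fun h => (Finset.mem_sdiff.1 (Finset.mem_erase.1 h).2).2 (List.mem_toFinset.2 hw₀)) ?_
  rw [Ne, Sym2.eq_iff]
  rintro (⟨-, h⟩ | ⟨h, -⟩)
  · exact hp h
  · exact h₀.ne h

/-- In the source position `a = {x, w₀}` (`x ∉ Λ`, `v ∉ a`), the slit domain `(Λ ∖ γ) ∖ {v}` of a
first arrival `γ` at any port `w` of `v` carries no walk STARTING on the mid-edge `{v, w₀}`: both
`v` and `w₀ ∈ γ` are off the slit domain. [folklore] -/
theorem isEmpty_slitLoop_from_src {Λ : Finset HexVertex} {x w₀ v w : HexVertex}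
    {z : Sym2 HexVertex} (hx : x ∉ Λ) (hva : v ∉ s(x, w₀))
    (γ : HexMidEdgeSAW Λ s(x, w₀) s(v, w)) :
    IsEmpty (HexMidEdgeSAW ((Λ \ γ.verts.toFinset).erase v) s(v, w₀) z) := by
  have hw₀ : w₀ ∈ γ.verts := src_mem_verts hx (fun h => hva (h ▸ Sym2.mem_mk_left v w)) γ
  exact isEmpty_saw_of_notMem_fst (fun h => (Finset.mem_erase.1 h).1 rfl)
    (fun h => (Finset.mem_sdiff.1 (Finset.mem_erase.1 h).2).2 (List.mem_toFinset.2 hw₀))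

/-! ### The two statements -/

/-- **Raw middle-port dominance implies dressed middle-port dominance (touching neighbour off the
source).** Let `Λ` be simply connected with source `a ∈ ∂Ω`, `v ∈ Λ` off `a` with neighbours
`w₀, w₁, w₂` in the positive order, `w₀ ∈ Λ` off `a` touching the complement (`w₀ ∼ x ∉ Λ`, third
neighbour `y`). If the RAW first-arrival masses `N_w = Σ_{γ : a → {v,w}, v ∉ γ} x_c^{ℓ(γ)}` satisfy
`min(N_{w₀}, N_{w₂}) ≤ N_{w₁}` when `y → w₀ → v` turns left and `min(N_{w₀}, N_{w₁}) ≤ N_{w₂}` when it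
turns right, then the same holds for the DRESSED masses (hypothesis `hdom` of `noFold_collarTwo`):
every dressed mass is at most `α_T` times the raw one (loop sums are nonnegative), and the middle
port's dressed mass is exactly `α_T` times the raw one since it carries no slit loop
(`middle_port_no_slit_loop`). [folklore] -/
theorem dom_of_rawDominance
    (hraw : ∀ (Λ : Finset HexVertex), hexDomainSimplyConnected Λ → ∀ a ∈ hexDomainBoundary Λ,
      ∀ v ∈ Λ, v ∉ a → ∀ w₀ w₁ w₂ x y : HexVertex, hexGraph.Adj v w₀ → hexGraph.Adj v w₁ →
      hexGraph.Adj v w₂ → w₀ ≠ w₁ → w₁ ≠ w₂ → w₀ ≠ w₂ → w₀ ∈ Λ → w₀ ∉ a →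
      winding [hexMidpoint s(w₀, v), hexCenter v, hexMidpoint s(v, w₁)] = Real.pi / 3 →
      hexGraph.Adj w₀ x → hexGraph.Adj w₀ y → v ≠ x → x ≠ y → v ≠ y → x ∉ Λ →
      let N : HexVertex → ℝ := fun w =>
        ∑ γ : HexMidEdgeSAW Λ a s(v, w), if v ∉ γ.verts then hexCriticalFugacity ^ γ.length else 0
      (winding [hexMidpoint s(y, w₀), hexCenter w₀, hexMidpoint s(w₀, v)] = Real.pi / 3 →
          min (N w₀) (N w₂) ≤ N w₁) ∧
        (winding [hexMidpoint s(y, w₀), hexCenter w₀, hexMidpoint s(w₀, v)] = -(Real.pi / 3) →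
          min (N w₀) (N w₁) ≤ N w₂)) :
    ∀ (Λ : Finset HexVertex), hexDomainSimplyConnected Λ → ∀ a ∈ hexDomainBoundary Λ,
      ∀ v ∈ Λ, v ∉ a → ∀ w₀ w₁ w₂ x y : HexVertex, hexGraph.Adj v w₀ → hexGraph.Adj v w₁ →
      hexGraph.Adj v w₂ → w₀ ≠ w₁ → w₁ ≠ w₂ → w₀ ≠ w₂ → w₀ ∈ Λ → w₀ ∉ a →
      winding [hexMidpoint s(w₀, v), hexCenter v, hexMidpoint s(v, w₁)] = Real.pi / 3 →
      hexGraph.Adj w₀ x → hexGraph.Adj w₀ y → v ≠ x → x ≠ y → v ≠ y → x ∉ Λ →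
      let xc : ℝ := hexCriticalFugacity
      let α : ℝ := 1 + 2 * hexCriticalFugacity * Real.cos (5 * Real.pi / 24)
      let s : (w p q : HexVertex) → ℝ := fun w p q =>
        ∑ γ : HexMidEdgeSAW Λ a s(v, w), if v ∉ γ.verts then xc ^ γ.length *
          (α - Real.sqrt 3 * xc *
            ∑ δ : HexMidEdgeSAW ((Λ \ γ.verts.toFinset).erase v) s(v, p) s(v, q), xc ^ δ.length) else 0
      (winding [hexMidpoint s(y, w₀), hexCenter w₀, hexMidpoint s(w₀, v)] = Real.pi / 3 →
          min (s w₀ w₁ w₂) (s w₂ w₀ w₁) ≤ s w₁ w₂ w₀) ∧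
        (winding [hexMidpoint s(y, w₀), hexCenter w₀, hexMidpoint s(w₀, v)] = -(Real.pi / 3) →
          min (s w₀ w₁ w₂) (s w₁ w₂ w₀) ≤ s w₂ w₀ w₁) := by
  intro Λ hΛ a ha v hv hva w₀ w₁ w₂ x y h₀ h₁ h₂ h₀₁ h₁₂ h₀₂ hw₀ hw₀a hchir hwx hwy hvx hxy hvy hx
  have hN := hraw Λ hΛ a ha v hv hva w₀ w₁ w₂ x y h₀ h₁ h₂ h₀₁ h₁₂ h₀₂ hw₀ hw₀a hchir hwx hwy hvx
    hxy hvy hx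
  have hM := middle_port_no_slit_loop Λ hΛ a ha v hv hva w₀ w₁ w₂ x y h₀ h₁ h₂ h₀₁ h₁₂ h₀₂ hw₀
    hw₀a hchir hwx hwy hvx hxy hvy hx
  dsimp only at hN ⊢
  exact ⟨fun hl => min_le_of_le_mul nfb_alphaT_pos.le
      (dressedMass_le_alphaT_mul_rawMass Λ a v w₀ w₁ w₂)
      (dressedMass_le_alphaT_mul_rawMass Λ a v w₂ w₀ w₁)
      (dressedMass_eq_alphaT_mul_rawMass Λ a v w₁ w₂ w₀ (hM.1 hl)) (hN.1 hl),
    fun hr => min_le_of_le_mul nfb_alphaT_pos.le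
      (dressedMass_le_alphaT_mul_rawMass Λ a v w₀ w₁ w₂)
      (dressedMass_le_alphaT_mul_rawMass Λ a v w₁ w₂ w₀)
      (dressedMass_eq_alphaT_mul_rawMass Λ a v w₂ w₀ w₁ (hM.2 hr)) (hN.2 hr)⟩

/-- **Raw middle-port dominance implies dressed middle-port dominance (touching neighbour on the
source).** The same as `dom_of_rawDominance` with the touching neighbour `w₀` the inner endpoint of
the source mid-edge, `a = {x, w₀}` (hypothesis `hdomSrc` of `noFold_collarTwo`). Here the middle
port carries no slit loop for a simpler reason: every walk from `a` starts at `w₀`, so `w₀` (like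
`v`) is not a vertex of the slit domain `(Λ ∖ γ) ∖ {v}`, which therefore has no walk from or to the
mid-edge `{v, w₀}`. [folklore] -/
theorem domSrc_of_rawDominanceSrc
    (hrawSrc : ∀ (Λ : Finset HexVertex), hexDomainSimplyConnected Λ → ∀ a ∈ hexDomainBoundary Λ,
      ∀ v ∈ Λ, v ∉ a → ∀ w₀ w₁ w₂ x y : HexVertex, hexGraph.Adj v w₀ → hexGraph.Adj v w₁ →
      hexGraph.Adj v w₂ → w₀ ≠ w₁ → w₁ ≠ w₂ → w₀ ≠ w₂ → w₀ ∈ Λ → a = s(x, w₀) →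
      winding [hexMidpoint s(w₀, v), hexCenter v, hexMidpoint s(v, w₁)] = Real.pi / 3 →
      hexGraph.Adj w₀ x → hexGraph.Adj w₀ y → v ≠ x → x ≠ y → v ≠ y → x ∉ Λ →
      let N : HexVertex → ℝ := fun w =>
        ∑ γ : HexMidEdgeSAW Λ a s(v, w), if v ∉ γ.verts then hexCriticalFugacity ^ γ.length else 0
      (winding [hexMidpoint s(y, w₀), hexCenter w₀, hexMidpoint s(w₀, v)] = Real.pi / 3 →
          min (N w₀) (N w₂) ≤ N w₁) ∧
        (winding [hexMidpoint s(y, w₀), hexCenter w₀, hexMidpoint s(w₀, v)] = -(Real.pi / 3) →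
          min (N w₀) (N w₁) ≤ N w₂)) :
    ∀ (Λ : Finset HexVertex), hexDomainSimplyConnected Λ → ∀ a ∈ hexDomainBoundary Λ,
      ∀ v ∈ Λ, v ∉ a → ∀ w₀ w₁ w₂ x y : HexVertex, hexGraph.Adj v w₀ → hexGraph.Adj v w₁ →
      hexGraph.Adj v w₂ → w₀ ≠ w₁ → w₁ ≠ w₂ → w₀ ≠ w₂ → w₀ ∈ Λ → a = s(x, w₀) →
      winding [hexMidpoint s(w₀, v), hexCenter v, hexMidpoint s(v, w₁)] = Real.pi / 3 →
      hexGraph.Adj w₀ x → hexGraph.Adj w₀ y → v ≠ x → x ≠ y → v ≠ y → x ∉ Λ →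
      let xc : ℝ := hexCriticalFugacity
      let α : ℝ := 1 + 2 * hexCriticalFugacity * Real.cos (5 * Real.pi / 24)
      let s : (w p q : HexVertex) → ℝ := fun w p q =>
        ∑ γ : HexMidEdgeSAW Λ a s(v, w), if v ∉ γ.verts then xc ^ γ.length *
          (α - Real.sqrt 3 * xc *
            ∑ δ : HexMidEdgeSAW ((Λ \ γ.verts.toFinset).erase v) s(v, p) s(v, q), xc ^ δ.length) else 0
      (winding [hexMidpoint s(y, w₀), hexCenter w₀, hexMidpoint s(w₀, v)] = Real.pi / 3 →
          min (s w₀ w₁ w₂) (s w₂ w₀ w₁) ≤ s w₁ w₂ w₀) ∧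
        (winding [hexMidpoint s(y, w₀), hexCenter w₀, hexMidpoint s(w₀, v)] = -(Real.pi / 3) →
          min (s w₀ w₁ w₂) (s w₁ w₂ w₀) ≤ s w₂ w₀ w₁) := by
  intro Λ hΛ a ha v hv hva w₀ w₁ w₂ x y h₀ h₁ h₂ h₀₁ h₁₂ h₀₂ hw₀ hax hchir hwx hwy hvx hxy hvy hx
  have hN := hrawSrc Λ hΛ a ha v hv hva w₀ w₁ w₂ x y h₀ h₁ h₂ h₀₁ h₁₂ h₀₂ hw₀ hax hchir hwx hwy hvx
    hxy hvy hx
  dsimp only at hN ⊢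
  subst hax
  exact ⟨fun hl => min_le_of_le_mul nfb_alphaT_pos.le
      (dressedMass_le_alphaT_mul_rawMass Λ _ v w₀ w₁ w₂)
      (dressedMass_le_alphaT_mul_rawMass Λ _ v w₂ w₀ w₁)
      (dressedMass_eq_alphaT_mul_rawMass Λ _ v w₁ w₂ w₀
        (fun γ _ => isEmpty_slitLoop_to_src hx hva h₀ h₀₂.symm γ)) (hN.1 hl),
    fun hr => min_le_of_le_mul nfb_alphaT_pos.le
      (dressedMass_le_alphaT_mul_rawMass Λ _ v w₀ w₁ w₂)
      (dressedMass_le_alphaT_mul_rawMass Λ _ v w₁ w₂ w₀)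
      (dressedMass_eq_alphaT_mul_rawMass Λ _ v w₂ w₀ w₁
        (fun γ _ => isEmpty_slitLoop_from_src hx hva γ)) (hN.2 hr)⟩

end Summit.CriticalPhenomena.SAWScalingLimit.Theorems.SAWDevelopingMapNoFoldBound

end
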